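import Mathlib
import HarnessLib
import HarnessLib.Audit
import Summits.AtomisticToContinuum.Statement
import Literature.MathematicalPhysics.QuantumManyBody.PeriodicBoseGas

/-!
Route: BECTiltCommutation

CLOSED (retired) 2026-08-15T13:41:04Z by operator:999:1257524 — reason: not-a-thesis: assembly does not conclude the sub-problem Statement — note: D-0027 §2.1 audit (human 2026-08-15: routes that do not decide the summit are removed): the assembly concludes `Literature.MathematicalPhysics.QuantumManyBody.BoseGas.BoseEinsteinCondensation`, not the sub-problem statement; a NEW conforming route may be opened from the same idea (generated `closes . The file is kept as the record of this route; refuted decls are indexed as negative knowledge (`ledger negatives`).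

# Route BECTiltCommutation — Dirichlet BEC from torus BEC by commuting two tilts of the positive
ground-state measure (walls vs tagged boson), diagonal cruxes only

It suffices to show X = TiltCommutation ∧ BulkIndistinguishability ∧ PeriodicBEC (card
bc-transfer-influence-factorisation, a MECHANISM for
route BECPeriodicReduction's orphan crux BoundaryTransferWeak, stmt-AtomisticToContinuum-0827). All
three parts are statements about GROUND
STATES (L²-limits of minimising sequences; N = n+1, L = (N/ρ)^(1/3)): PeriodicBEC (shared verbatim
with stmt-0826) is the only OFF-DIAGONAL
input and lives on the torus; the two new cruxes are DIAGONAL statements about the positive measures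
|Ψ_D|² (Dirichlet box) and |Ψ_P|² (torus of
the same side): (C1) TiltCommutation — the Palm law of |Ψ_D|² at a bulk point x equals the tilt of
the Dirichlet (N−1)-marginal by the PERIODIC
insertion (Papangelou) weight, in density-weighted mean total variation o(1): wall tilt and tag tilt
commute; (C2) BulkIndistinguishability —
the normalised two-point insertion affinities of the wall-tilted environment dominate the torus Palm
affinities up to o(N²) in ρ⊗ρ-weighted mean.
Because for a positive wave function γ(x,y) = √(ρ₁(x)ρ₁(y))·BC(P_x,P_y) is a functional of the
diagonal measure, C1 ∧ C2 turn torus ODLRO into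
occupation ≥ cN of the Dirichlet ground state's own density mode √(ρ_Φ/N) (support PairAlgebra,
TorusAveraging), and near-minimiser compactness
(support GroundStateReduction) gives HasGroundStateBEC, i.e. the conjunct.
Lean: `TiltCommutation ∧ BulkIndistinguishability ∧ PeriodicBEC` (the three `def`s under ## Cruxes;
every constant is `Literature.MathematicalPhysics.QuantumManyBody.BoseGas.*`, `Matrix.vecCons`,
`ENNReal.*`, `Filter.*`, `Measurable`, `Real.sqrt`; all seven items elaborate, rc 0, in Sketch.lean)

## Assembly
Quantifier bookkeeping only (no analysis): to prove the conjunct apply GroundStateReduction; its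
hypothesis (Dirichlet ground-state coherence)
is produced per v as follows — take ρ₀ = min of the thresholds of TiltCommutation,
BulkIndistinguishability and TorusAveraging(PeriodicBEC); for
ρ < ρ₀ get c > 0 from TorusAveraging, put η := (c/16)² (so 4η + 4√η ≤ c/2 as η ≤ 1 may be assumed by
shrinking c) and intersect the three
`∀ᶠ n` sets; for a Dirichlet ground state Φ pick the periodic ground state Θ supplied by
TorusAveraging (weight ρ_Φ), feed the C1 and C2
inequalities for (Φ, Θ) and the coherence inequality into PairAlgebra (its measurability / support /
normalisation hypotheses are conjuncts of the
ground-state predicate) and read off Q(Φ) ≥ (c/2)·N. Items at open: 7 (3 cruxes, 3 support, 1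
assembly).

Rationale: WHY THIS LINE. Energy comparison cannot transfer condensation between boundary conditions at the
thermodynamic box (wall terms ≫ the N/L² coherence scale;
BECPeriodicReduction rationale, LSSY2005 Ch. 2 after (2.8) transfers the ENERGY only), so the
transfer must be structural; positivity of both
ground states makes the one-particle density matrix a Bhattacharyya affinity of Palm measures
(point-process theory: Campbell–Mecke / GNZ,
LastPenrose2017, Kallenberg2021), and in the Papangelou normalisation the extensive part of the wall
weight |Ψ_D|²/|Ψ_P|² cancels identically, leaving
only the wall×tag CONNECTED influence, an infrared-convergent quantity in d = 3 (∫_{k<1/d}|û|²S ~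
(ξ/d)² with the Reatto–Chester phonon tail
û ~ 1/|k| and S(k) ~ |k|, ReattoChester1967) — this is the imported area: Palm/Papangelou calculus
and Dobrushin-type influence bounds
(Dobrushin1968) for tilts of a spatially mixing measure, pointed at the ground-state measure. What
the line does that prior routes do not:
BECPeriodicReduction files BoundaryTransferWeak with no mechanism,
BECInfraredBound/BECRenormGroup/BECPinning work on the Dirichlet box with
the constant mode (refuter artefact (8/π²)³) or on the torus; here the Dirichlet conclusion is
mode-free (the state's own density mode), the
off-diagonal input is consumed as a black box (PeriodicBEC), and the two new cruxes are diagonal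
(|Ψ₀|²-only) statements, exactly true at v = 0.

RANKED CRUXES. #2 TiltCommutation (crux) — (card TRANSFER LEMMA, integrated) For every repulsive
finite-range v there is ρ₀ > 0 such that for 0 < ρ < ρ₀ and every η > 0, for all large N = n+1 (L =
(N/ρ)^(1/3)), for every Dirichlet ground state Φ (measurable, supported in the box, normalised,
E₀(N,L) < ∞, L²-limit of a minimising sequence of TrialStates) and every periodic ground state Θ of
the torus of the SAME side (same data with PeriodicTrialState, E₀^per < ∞): with ρ_Φ(x) =
N∫|Φ(x,Y)|²dY, m_Φ(Y) = ∫|Φ(z,Y)|²dz (Dirichlet (N−1)-marginal), λ(x;Y) =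
|Θ(x,Y)|²1_cell/∫|Θ(z,Y)|²1_cell dz (periodic insertion = Papangelou weight) and π_x(Y) =
λ(x;Y)m_Φ(Y)/∫λ(x;W)m_Φ(W)dW (the tilted law), one has ∫dx∫dY |N|Φ(x,Y)|² − ρ_Φ(x)π_x(Y)| ≤ ηN. In
words: the Palm law of |Φ|² at x IS the periodic-insertion tilt of the wall-tilted marginal, in
density-weighted mean total variation — wall tilt and tag tilt commute; equivalently
λ_D(x;·)/λ_P(x;·) is a deterministic envelope a(x) = ρ_Φ(x)/Z(x) up to an L¹-small cross term (the
Y-only, extensive part of the wall weight cancels in the normalisation). Exact (error 0) at v = 0.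
[difficulty: XL] (why it might fail: Needs the wall×tag CONNECTED influence to be o(1) per particle
in L¹ at fixed ρ as L→∞ (heuristic (ξ/d)²√(ρa³), IR-finite only because S(k)~k, û~1/k in d=3); a
non-vanishing O(√(ρa³)) cross term, or degenerate ground states (hard cores), break the ∀η>0 form.)
[LastPenrose2017, Kallenberg2021, Dobrushin1968, ReattoChester1967, LSSY2005, Robinson1976,
KonigVogelZass2025, arXiv:2312.07481]
#3 BulkIndistinguishability (crux) — (card BULK INDISTINGUISHABILITY, affinity form) Same data and
the same ρ_Φ, m_Φ, λ, π as in TiltCommutation, plus the torus Palm affinity b_Θ(x,y) =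
L³∫|Θ(x,Y)||Θ(y,Y)|1_cell dY (= L³γ_Θ(x,y)/N, the Bhattacharyya affinity of the periodic Palm laws
for the translation-invariant ground state): ∫∫ρ_Φ(x)ρ_Φ(y)·[b_Θ(x,y) − BC(π_x,π_y)]₊ dx dy ≤ ηN²,
where BC(π_x,π_y) = ∫√(π_x(Y)π_y(Y))dY. In words: two bulk insertions see the same environment
statistics under the wall-tilted (N−1)-marginal m_Φ as under the torus marginal m_Θ; at separations
≫ ξ this is (i) equality of the ONE-POINT insertion statistic (E√λ_x)²/Eλ_x (the condensate fraction
of the positivity identities) in the bulk of the box and on the torus, plus (ii) decorrelation of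
distant insertions under m_Φ (mixing). One-sided (only the lower bound on BC is consumed); pairs
near the walls are discounted by the weight ρ_Φ⊗ρ_Φ (boundary-layer mass fraction ~ 6ξ/L → 0). Exact
at v = 0 (b_Θ ≡ 1 ≡ BC). [deps: TiltCommutation] [difficulty: XL] (why it might fail: It is
BC-independence of bulk LOCAL statistics of |Ψ₀|² plus mixing of the wall-tilted measure: an
infinite-volume uniqueness statement for the ground-state point process, nothing in print for v≠0
(Dobrushin bounds need a quasilocal specification); phonon tails (û~1/k) make λ only quasi-local.)
[Dobrushin1968, Georgii1994, VandenbergLewisPule1986, PuleZagrebnov2004, BoccatoSeiringer2023,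
Junge2026, LSSY2005, LastPenrose2017]
#4 PeriodicBEC (crux) — (shared verbatim with stmt-AtomisticToContinuum-0826 of route
BECPeriodicReduction; the only off-diagonal input, consumed as a black box) For every repulsive
finite-range radial v there is ρ₀>0 such that for 0<ρ<ρ₀ there is c>0 with: for all large N there is
δ>0 such that every PERIODIC trial state Ψ on the torus of side L=(N/ρ)^(1/3) with periodicEnergy ≤
E₀^per(N,L)+δ has constant-mode occupation condensateOccupation N L Ψ ≥ cN. This route adds nothing
to its proof (method routes: BECScaleInduction/BECFeynmanKacCycles/BECPinning's periodic crux) and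
is parked until it lands. [difficulty: open-problem] (why it might fail: Box L=(N/ρ)^{1/3}→∞ at
fixed ρ: every printed bound on n₊ pays the inverse kinetic gap L², so it is o(N) only up to
L≲a(ρa³)^{-3/4-η} (Fournais2020 Thm 1.2; Junge2026 Cor 6); T=0 Bogoliubov expansions diverge in d=3;
hard cores v=⊤ are admissible and c must be uniform in N.) [LiebSeiringerSolovejYngvason2005,
Fournais2020, arXiv:2011.00309, Junge2026, arXiv:2603.20776, ChongLiangNam2026, arXiv:2510.20493,
Literature.Barriers.AtomisticToContinuum.KineticGapLengthScales]
#9 PairAlgebra (support) — (affinity algebra, per instance, no ground-state hypotheses — the glue of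
layer 1) For any n, L, η ≥ 0, c and measurable Φ, Θ : Config(n+1) → ℂ with Φ supported in the box
and ∫|Φ|² = 1: the TiltCommutation inequality (error η), the BulkIndistinguishability inequality
(error η) and the weighted torus coherence c·N·(∫_cell ρ_Φ)² ≤ N∫∫ρ_Φ(x)ρ_Φ(y)b_Θ(x,y) imply Q(Φ) :=
∫dY(∫√ρ_Φ(x)·|Φ(x,Y)|dx)² ≥ (c − 4η − 4√η)·N. Proof (true constant 2η+2√η): Q =
(1/N)∫∫√(ρ_Φ(x)ρ_Φ(y))γ^abs_Φ(x,y) with γ^abs_Φ(x,y) = ∫√(a_x a_y)dY, a_x(Y) = N|Φ(x,Y)|²; Hellinger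
step |∫√(a_x a_y) − ∫√(b_x b_y)| ≤ √(‖a_x−b_x‖₁·∫a_y) + √(∫b_x·‖a_y−b_y‖₁) (|√s−√t|² ≤ |s−t|,
Cauchy–Schwarz) with b_x = ρ_Φ(x)π_x, ∫√(b_x b_y) = √(ρ_Φ(x)ρ_Φ(y))·BC(π_x,π_y); Cauchy–Schwarz in x
against ρ_Φ (total mass N) turns the C1 error ηN into 2√η·N + ηN; C2 gives ∫∫ρρBC ≥ ∫∫ρρ b_Θ − ηN²;
the coherence hypothesis gives ∫∫ρρ b_Θ ≥ cN². [deps: TiltCommutation, BulkIndistinguishability]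
[difficulty: provable-now] [PenroseOnsager1956, LSSY2005, folklore (Bhattacharyya/Hellinger
inequalities)]
#9 TorusAveraging (support) — PeriodicBEC → weighted torus coherence for ground states: for every
repulsive finite-range v there is ρ₀ such that for ρ<ρ₀ there is c>0 with, for all large N = n+1 and
every Dirichlet ground state Φ, SOME periodic ground state Θ (a translate of an L²-limit of a
periodic minimising sequence) satisfying c·N·(∫_cell ρ_Φ)² ≤ N∫∫ρ_Φ(x)ρ_Φ(y)b_Θ(x,y). Proof: E₀^per
< ∞ at low density (disjoint symmetric bumps, ρR₀³ small); bounded kinetic energy + Rellich on the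
torus give L²-limits Θ₀ of minimising sequences, and n₀(Θ₀) ≥ cN by PeriodicBEC and L²-continuity of
condensateOccupation; translates Θ_t are again such limits; for f = ρ_Φ ≥ 0: N∫∫f f b_{Θ_t} ≥
L³⟨f,γ_{Θ_t}f⟩ = L³N∫dY|∫f(x)Θ₀(x+t,Y)dx|² (torus change of variables), and the t-average of the
last integral is ≥ |average|² = L⁻⁶(∫f)²|∫Θ₀(z,Y)dz|² (Jensen), i.e. avg_t N∫∫ffb_{Θ_t} ≥
n₀(Θ₀)(∫f)² ≥ cN(∫f)²; pick t above the average. No Fourier series needed. [deps: PeriodicBEC]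
[difficulty: L] [Fournais2020, ReedSimonIV1978, LSSY2005]
#9 GroundStateReduction (support) — Dirichlet ground-state coherence → the conjunct: if for every
repulsive finite-range v there are ρ₀, and for ρ<ρ₀ some c>0, such that for all large N every
Dirichlet ground state Φ (as in TiltCommutation) has Q(Φ) = ∫dY(∫√ρ_Φ(x)|Φ(x,Y)|dx)² ≥ cN, then
BoseEinsteinCondensation. Proof: fix v, ρ < ρ₀' := min(ρ₀, finiteness threshold) so that E₀(N,L) < ∞
for large N; if for every δ>0 some δ-near-minimiser had maxOccupation < (c/2)N, a minimising
sequence of such states would converge in L² (Rellich for C¹ functions vanishing off the box with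
bounded Dirichlet integral) to a ground state Φ; uniqueness/positivity of the Dirichlet ground state
(Perron–Frobenius for −Δ+V on the connected admissible region, Reed–Simon XIII.47; hard cores:
connectedness at low density) gives Φ(·,Y) of constant phase, so the occupation of the FIXED
normalised mode u = √(ρ_Φ/N) in Ψ_k tends to N∫|∫ūΦ|² = Q(Φ) ≥ cN — contradiction; finish with
occupation_le_maxOccupation and le_condensateNumber (pattern of
AtomisticToContinuum.BECInfraredBound.bec_of_zeroMode). This is where all
near-minimiser/compactness/phase plumbing of the conjunct's variational formalisation is paid, once.
[difficulty: L] [ReedSimonIV1978, LSSY2005, LiebSeiringerSolovejYngvason2005, in-tree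
AtomisticToContinuum.BECInfraredBound.bec_of_zeroMode]

TWO-LAYER PLAN. Foreseen glued splits (k ≤ 3, depth 1; nothing filed now): TiltCommutation ⇐
EnvelopeFactorisation (λ_D(x;·) = a(x)λ_P(x;·)(1+r) on the
m_Φ-typical set, one bulk point) → CrossInfluenceDecay (E|r| ≤ η(dist(x,∂Λ)) with η(d) → 0, the
Dobrushin/Feynman–Kac influence estimate) →
TiltCommutation; BulkIndistinguishability ⇐ OnePointIndistinguishability ((E√λ_x)²/Eλ_x under m_Φ vs
m_Θ, bulk x) → InsertionDecorrelation
(mixing of distant insertions under m_Φ) → BulkIndistinguishability; GroundStateReduction ⇐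
NearMinimiserCompactness → PhaseRigidity →
GroundStateReduction. A Jastrow-anchor special case of C1/C2 (Φ, Θ replaced by Dirichlet/periodic
Jastrow products, classical Gibbs measures)
is the natural first child if a prover wants a provable-now rung.

KILL CRITERIA. ¬TiltCommutation or ¬BulkIndistinguishability for some admissible v at arbitrarily
small ρ (e.g. a proof that the wall×tag connected influence
per particle stays ≥ c√(ρa³) as L → ∞, or that Dirichlet bulk Palm affinities fall below the torus
ones by a fixed amount) closes the route
(`close --reason refuted:<Decl>`) but not the conjunct and not BECPeriodicReduction. ¬PeriodicBEC
kills this route, BECPeriodicReduction and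
(physically) the conjunct. BoundaryTransferWeak (stmt-0827) proved by another mechanism (card
wall-dressing-transfer) ⇒ close superseded. A
refutation that only breaks the ∀η>0 form (error small but not vanishing) forces a pivot: re-file
C1/C2 with error ≤ κ(ρ)N, κ(ρ) → 0 as ρ → 0,
and consume a quantitative PeriodicBEC (c(ρ) → 1).

NOT DECOMPOSED YET. The influence technology itself (Dobrushin/Künsch bounds presuppose a quasilocal
specification that |Ψ₀|² lacks — audit-5's costume check;
the intended arena is the ground-state Feynman–Kac path measure where walls = killing and the tag =
an inserted world-line are genuine local
factors); existence / uniqueness / H¹-compactness of ground states in the C¹ variational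
formalisation (inside the support items, paid once);
the rate η(d); the Jastrow and mean-field anchors; T > 0; Casimir (anisotropic) boxes; any attempt
on PeriodicBEC (other routes).

CHEAPEST FALSIFIER. v = 0, done by hand this session: Φ = ∏ᵢ φ₁(xᵢ) (Dirichlet sine product), Θ =
L^(−3N/2); then λ ≡ L⁻³, π_x = m_Φ = P^Φ_x exactly, so the
C1 integrand vanishes identically; b_Θ ≡ 1 ≡ BC(π_x,π_y), so C2's integrand vanishes; TorusAveraging
holds with c = 1 and Q(Φ) = N·(∫φ₁²)² = N —
the line PASSES where the constant-mode routes see the (8/π²)³ artefact. Next cheapest (refuter,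
kit-sized): the Jastrow anchor — replace Φ, Θ by
∏φ_GP(xᵢ)∏f(xᵢ−xⱼ) (box) and ∏f (torus); C1's error is then the mass within range R₀ of the walls (→
0) and C2 becomes equality of the bulk
one-point insertion statistic (E√λ)²/Eλ of two classical low-activity Gibbs measures differing by a
boundary field — classical Dobrushin
uniqueness territory; a Monte-Carlo estimate of that statistic under both measures (N ~ 10³, growing
L at fixed ρa³) that drifts apart would
retire the card.

NUMBERS. Free gas: Dirichlet constant-mode fraction (8/π²)³ ≈ 0.533 (refuter notes on
stmt-0689/0733) — the reason the conclusion uses the state's own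
density mode √(ρ_Φ/N), for which v = 0 gives fraction 1. Healing length ξ = (8πρa)^(−1/2);
boundary-layer mass fraction ≈ 6ξ/L =
6(8πρa)^(−1/2)(ρ/N)^(1/3) → 0 at fixed ρ; heuristic cross influence at distance d: (ξ/d)²√(ρa³),
density-averaged ∫(ξ/d)²dx/L³ ~ ξ/L → 0.
Printed BEC length scales to beat: L ≲ (ρa)^(−1/2)(ρa³)^(−δ) (Fournais2020 Thm 1.2), R ~
a(ρa³)^(−3/4−η) (Junge2026 Cor. 6) versus L = (N/ρ)^(1/3).
Items at open: 7.

DEFINITION REQUESTS. None required: Palm laws, Papangelou weights, tilted laws and affinities are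
inlined as lintegrals over `Matrix.vecCons x Y` (N = n+1), and
"ground state" is the inline predicate (measurable, supported/normalised, E₀ ≠ ⊤, L²-limit of a
minimising sequence). Recommended once a second
route needs them (cards palm-hellinger-debye-landscape, renyi-entropic-delocalisation,
wall-dressing-transfer): Literature defs
`IsDirichletGroundState`, `IsPeriodicGroundState`, `palmDensity`, `papangelouWeight` under
Literature/MathematicalPhysics/QuantumManyBody, which would
shrink every signature here by ~70%.

Novelty: Searches (2026-08-15, this session): `lit frontier AtomisticToContinuum --since 2022` (30 rows; BEC
descendants arXiv:2603.20776, arXiv:2510.20493,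
arXiv:2602.16566 — none on boundary-condition transfer of the condensate); `lit search --source
zbmath` ×3 ("boundary condition independence
one-particle density matrix interacting Bose gas ground state thermodynamic limit" 0; "Papangelou
intensity quantum ground state" 0;
"Bose-Einstein condensation boundary conditions interacting" 10, relevant: KonigVogelZass2025 =
arXiv:2312.07481, point-process ODLRO for the
FREE gas); `lit search --source crossref` ("Palm measure positive ground state Bose condensate
off-diagonal long-range order": ODLRO classics
only, doi:10.1063/1.1704372 Girardeau 1965); `lit search --hybrid` ("dependence of the condensate on
boundary conditions Dirichlet periodic
interacting Bose gas ground state": textbooks only, LSSY pp. 35/40); `lit galaxy search --star all`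
×2 (0 hits both phrasings); plus the card's
and the two novelty audits' searches (zbMATH/crossref, recorded on the card: Robinson1976,
Landau–Wilde 1979, VandenbergLewisPule1986 — BC
dependence of BEC for the FREE gas only; doi:10.1063/1.1704276 Ginibre 1965 — BC-independent reduced
density matrices by cluster expansion in the
NON-condensed regime; LSSY2005 Ch. 2 after (2.8), Basti2022 = arXiv:2203.01841 p. 3 — BC transfer of
the ENERGY; Junge2026 Thm 3 — Neumann
localisation inequality).
Nearest prior art found: LSSY2005 Ch. 2 (energy-level BC ind  [refs: 10.1063/1.1704372, 10.1063/1.1704276, 2603.20776, 2510.20493, 2602.16566, 2312.07481, 2203.01841, doi:10.1063/1.1704372, doi:10.1063/1.1704276, KonigVogelZass2025, Robinson1976, VandenbergLewisPule1986, LSSY2005, Basti2022, Junge2026]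

Barriers (technique_class: boundary-condition-transfer palm-affinity influence-bounds): - technique_class: boundary-condition-transfer palm-affinity influence-bounds
- Literature.Barriers.AtomisticToContinuum.KineticGapLengthScales: evaded by the transfer cruxes —
no energy window, no gap, no localisation into sub-boxes; the items speak about ground states (exact
minimising-sequence limits) and a λ_max-type target, which KineticGapLengthScalesNarrow lists as NOT
bound; it APPLIES squarely to the shared crux PeriodicBEC, filed as a black box (the bet: a gap-free
torus mechanism lands first; this route is parked until then).
- Literature.Barriers.AtomisticToContinuum.EnergyAsymptoticsWithoutCondensation: evaded — no energy
asymptotics enter; energies appear only through E₀ < ∞ and minimising sequences defining the ground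
state.
- Literature.Barriers.AtomisticToContinuum.CasimirBoxGeneralizedCondensation: the relevant warning
(type of condensation depends on geometry/boundary); evaded because the statement is for cubes L =
(N/ρ)^(1/3) with a mode-free conclusion (occupation of √(ρ_Φ/N)), and C1/C2 carry explicit o(N)
errors that would not vanish for Casimir-anisotropic boxes — nothing is claimed there.
- Literature.Barriers.AtomisticToContinuum.SymmetryBreakingWithoutCondensate: not in scope —
canonical, first-quantised, no source field or quasi-average.
- Literature.Barriers.AtomisticToContinuum.BogoliubovPerturbationInfrared: evaded — no perturbative
expansion; the only infrared input is the heuristic SIZE of the cross influence ((ξ/d)², convergent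
in d = 3), whi

History (route lifecycle, newest last):
- 2026-08-15T13:41:04Z · CLOSED retired — not-a-thesis: assembly does not conclude the sub-problem Statement (operator:999:1257524)

sub-problem: BoseEinsteinCondensation · status: closed(retired) · opened planner-plancard-AtomisticToContinuum-BoseEin-03930835-0 2026-08-15T11:40:03Z · rev 0 · ledger route-AtomisticToContinuum-BECTiltCommutation
GENERATED by the gate from the ledger (D-0016/17). Provers cite these decls: `theorem foo : Summit.AtomisticToContinuum.BoseEinsteinCondensation.Theses.BECTiltCommutation.<Decl> := …` in Summits/AtomisticToContinuum/BoseEinsteinCondensation/Theorems/<Name>.lean.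
-/

namespace Summit.AtomisticToContinuum.BoseEinsteinCondensation.Theses.BECTiltCommutation

open scoped BigOperators Topology Manifold Classical MeasureTheory ProbabilityTheory Matrix InnerProductSpace ComplexConjugate ContinuousMap
open Filter Set Function TopologicalSpace MeasureTheory

attribute [summit_statement] _root_.BoseEinsteinCondensation

/-- item stmt-AtomisticToContinuum-5119 · crux · rank 2 · closed · moot by None · by planner
why it might fail: Needs the wall×tag CONNECTED influence to be o(1) per particle in L¹ at fixed ρ as L→∞ (heuristic (ξ/d)²√(ρa³), IR-finite only because S(k)~k, û~1/k in d=3); a non-vanishing O(√(ρa³)) cross term, or degenerate ground states (hard cores), break the ∀η>0 form.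
sources: LastPenrose2017, Kallenberg2021, Dobrushin1968, ReattoChester1967, LSSY2005, Robinson1976
[crux] (card TRANSFER LEMMA, integrated) For every repulsive finite-range v there is ρ₀ > 0 such
that for 0 < ρ < ρ₀ and every η > 0, for all large N = n+1 (L = (N/ρ)^(1/3)), for every Dirichlet
ground state Φ (measurable, supported in the box, normalised, E₀(N,L) < ∞, L²-limit of a minimising
sequence of TrialStates) and every periodic ground state Θ of the torus of the SAME side (same data
with PeriodicTrialState, E₀^per < ∞): with ρ_Φ(x) = N∫|Φ(x,Y)|²dY, m_Φ(Y) = ∫|Φ(z,Y)|²dz (Dirichlet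
(N−1)-marginal), λ(x;Y) = |Θ(x,Y)|²1_cell/∫|Θ(z,Y)|²1_cell dz (periodic insertion = Papangelou
weight) and π_x(Y) = λ(x;Y)m_Φ(Y)/∫λ(x;W)m_Φ(W)dW (the tilted law), one has ∫dx∫dY |N|Φ(x,Y)|² −
ρ_Φ(x)π_x(Y)| ≤ ηN. In words: the Palm law of |Φ|² at x IS the periodic-insertion tilt of the
wall-tilted marginal, in density-weighted mean total variation — wall tilt and tag tilt commute;
equivalently λ_D(x;·)/λ_P(x;·) is a deterministic envelope a(x) = ρ_Φ(x)/Z(x) up to an L¹-small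
cross term (the Y-only, extensive part of the wall weight cancels in the normalisation). Exact
(error 0) at v = 0. [difficulty: XL] -/
@[route_item "route-AtomisticToContinuum-BECTiltCommutation"]
def TiltCommutation : Prop :=
  ∀ v : ℝ → ENNReal, Literature.MathematicalPhysics.QuantumManyBody.BoseGas.IsRepulsiveFiniteRange v → ∃ ρ₀ : ℝ, 0 < ρ₀ ∧ ∀ ρ : ℝ, 0 < ρ → ρ < ρ₀ → ∀ η : ℝ, 0 < η → ∀ᶠ n : ℕ in Filter.atTop, ∀ L : ℝ, L = Literature.MathematicalPhysics.QuantumManyBody.BoseGas.sideLength ρ (n + 1) → ∀ Φ : Literature.MathematicalPhysics.QuantumManyBody.BoseGas.Config (n + 1) → ℂ, (Measurable Φ ∧ (∀ X, X ∉ Literature.MathematicalPhysics.QuantumManyBody.BoseGas.boxN (n + 1) L → Φ X = 0) ∧ (∫⁻ X, (‖Φ X‖₊ : ENNReal) ^ 2) = 1 ∧ Literature.MathematicalPhysics.QuantumManyBody.BoseGas.groundStateEnergy v (n + 1) L ≠ ⊤ ∧ ∃ Ψ : ℕ → Literature.MathematicalPhysics.QuantumManyBody.BoseGas.TrialState (n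 + 1) L, Filter.Tendsto (fun k => Literature.MathematicalPhysics.QuantumManyBody.BoseGas.energy v (Ψ k)) Filter.atTop (nhds (Literature.MathematicalPhysics.QuantumManyBody.BoseGas.groundStateEnergy v (n + 1) L)) ∧ Filter.Tendsto (fun k => ∫⁻ X, (‖(Ψ k).ψ X - Φ X‖₊ : ENNReal) ^ 2) Filter.atTop (nhds 0)) → ∀ Θ : Literature.MathematicalPhysics.QuantumManyBody.BoseGas.Config (n + 1) → ℂ, (Measurable Θ ∧ (∫⁻ X in Literature.MathematicalPhysics.QuantumManyBody.BoseGas.cellN (n + 1) L, (‖Θ X‖₊ : ENNReal) ^ 2) = 1 ∧ Literature.MathematicalPhysics.QuantumManyBody.BoseGas.periodicGroundStateEnergy v (n + 1) L ≠ ⊤ ∧ ∃ Ψ : ℕ → Literature.MathematicalPhysics.QuantumManyBody.BoseGas.PeriodicTrialState (n + 1) L, Filter.Tendsto (fun k => Literature.MathematicalPhysics.QuantumManyBody.BoseGas.periodicEnergy v (Ψ k)) Filter.atTop (nhds (Literature.MathematicalPhysics.QuantumManyBody.BoseGas.periodicGroundStateEnergy v (n + 1) L)) ∧ Filter.Tendsto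 (fun k => ∫⁻ X in Literature.MathematicalPhysics.QuantumManyBody.BoseGas.cellN (n + 1) L, (‖(Ψ k).ψ X - Θ X‖₊ : ENNReal) ^ 2) Filter.atTop (nhds 0)) → ∀ ρΦ : Literature.MathematicalPhysics.QuantumManyBody.BoseGas.Space → ENNReal, ρΦ = (fun x => ((n : ENNReal) + 1) * ∫⁻ Y : Literature.MathematicalPhysics.QuantumManyBody.BoseGas.Config n, (‖Φ (Matrix.vecCons x Y)‖₊ : ENNReal) ^ 2) → ∀ mΦ : Literature.MathematicalPhysics.QuantumManyBody.BoseGas.Config n → ENNReal, mΦ = (fun Y => ∫⁻ z : Literature.MathematicalPhysics.QuantumManyBody.BoseGas.Space, (‖Φ (Matrix.vecCons z Y)‖₊ : ENNReal) ^ 2) → ∀ lam : Literature.MathematicalPhysics.QuantumManyBody.BoseGas.Space → Literature.MathematicalPhysics.QuantumManyBody.BoseGas.Config n → ENNReal, lam = (fun x Y => ((Literature.MathematicalPhysics.QuantumManyBody.BoseGas.cellN (n + 1) L).indicator (fun X => (‖Θ X‖₊ : ENNReal) ^ 2) (Matrix.vecCons x Y)) / ∫⁻ z : Literature.MathematicalPhysics.QuantumManyBody.BoseGas.Space,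 ((Literature.MathematicalPhysics.QuantumManyBody.BoseGas.cellN (n + 1) L).indicator (fun X => (‖Θ X‖₊ : ENNReal) ^ 2) (Matrix.vecCons z Y))) → ∀ π : Literature.MathematicalPhysics.QuantumManyBody.BoseGas.Space → Literature.MathematicalPhysics.QuantumManyBody.BoseGas.Config n → ENNReal, π = (fun x Y => lam x Y * mΦ Y / ∫⁻ W : Literature.MathematicalPhysics.QuantumManyBody.BoseGas.Config n, lam x W * mΦ W) → ∫⁻ x : Literature.MathematicalPhysics.QuantumManyBody.BoseGas.Space, ∫⁻ Y : Literature.MathematicalPhysics.QuantumManyBody.BoseGas.Config n, ((((n : ENNReal) + 1) * (‖Φ (Matrix.vecCons x Y)‖₊ : ENNReal) ^ 2 - ρΦ x * π x Y) + (ρΦ x * π x Y - ((n : ENNReal) + 1) * (‖Φ (Matrix.vecCons x Y)‖₊ : ENNReal) ^ 2)) ≤ ENNReal.ofReal η * ((n : ENNReal) + 1)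

/-- item stmt-AtomisticToContinuum-5120 · crux · rank 3 · closed · moot by None · by planner
why it might fail: It is BC-independence of bulk LOCAL statistics of |Ψ₀|² plus mixing of the wall-tilted measure: an infinite-volume uniqueness statement for the ground-state point process, nothing in print for v≠0 (Dobrushin bounds need a quasilocal specification); phonon tails (û~1/k) make λ only quasi-local.
sources: Dobrushin1968, Georgii1994, VandenbergLewisPule1986, PuleZagrebnov2004, BoccatoSeiringer2023, Junge2026
[crux] (card BULK INDISTINGUISHABILITY, affinity form) Same data and the same ρ_Φ, m_Φ, λ, π as in
TiltCommutation, plus the torus Palm affinity b_Θ(x,y) = L³∫|Θ(x,Y)||Θ(y,Y)|1_cell dY (=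
L³γ_Θ(x,y)/N, the Bhattacharyya affinity of the periodic Palm laws for the translation-invariant
ground state): ∫∫ρ_Φ(x)ρ_Φ(y)·[b_Θ(x,y) − BC(π_x,π_y)]₊ dx dy ≤ ηN², where BC(π_x,π_y) =
∫√(π_x(Y)π_y(Y))dY. In words: two bulk insertions see the same environment statistics under the
wall-tilted (N−1)-marginal m_Φ as under the torus marginal m_Θ; at separations ≫ ξ this is (i)
equality of the ONE-POINT insertion statistic (E√λ_x)²/Eλ_x (the condensate fraction of the
positivity identities) in the bulk of the box and on the torus, plus (ii) decorrelation of distant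
insertions under m_Φ (mixing). One-sided (only the lower bound on BC is consumed); pairs near the
walls are discounted by the weight ρ_Φ⊗ρ_Φ (boundary-layer mass fraction ~ 6ξ/L → 0). Exact at v = 0
(b_Θ ≡ 1 ≡ BC). [deps: TiltCommutation] [difficulty: XL] -/
@[route_item "route-AtomisticToContinuum-BECTiltCommutation"]
def BulkIndistinguishability : Prop :=
  ∀ v : ℝ → ENNReal, Literature.MathematicalPhysics.QuantumManyBody.BoseGas.IsRepulsiveFiniteRange v → ∃ ρ₀ : ℝ, 0 < ρ₀ ∧ ∀ ρ : ℝ, 0 < ρ → ρ < ρ₀ → ∀ η : ℝ, 0 < η → ∀ᶠ n : ℕ in Filter.atTop, ∀ L : ℝ, L = Literature.MathematicalPhysics.QuantumManyBody.BoseGas.sideLength ρ (n + 1) → ∀ Φ : Literature.MathematicalPhysics.QuantumManyBody.BoseGas.Config (n + 1) → ℂ, (Measurable Φ ∧ (∀ X, X ∉ Literature.MathematicalPhysics.QuantumManyBody.BoseGas.boxN (n + 1) L → Φ X = 0) ∧ (∫⁻ X, (‖Φ X‖₊ : ENNReal) ^ 2) = 1 ∧ Literature.MathematicalPhysics.QuantumManyBody.BoseGas.groundStateEnergy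 v (n + 1) L ≠ ⊤ ∧ ∃ Ψ : ℕ → Literature.MathematicalPhysics.QuantumManyBody.BoseGas.TrialState (n + 1) L, Filter.Tendsto (fun k => Literature.MathematicalPhysics.QuantumManyBody.BoseGas.energy v (Ψ k)) Filter.atTop (nhds (Literature.MathematicalPhysics.QuantumManyBody.BoseGas.groundStateEnergy v (n + 1) L)) ∧ Filter.Tendsto (fun k => ∫⁻ X, (‖(Ψ k).ψ X - Φ X‖₊ : ENNReal) ^ 2) Filter.atTop (nhds 0)) → ∀ Θ : Literature.MathematicalPhysics.QuantumManyBody.BoseGas.Config (n + 1) → ℂ, (Measurable Θ ∧ (∫⁻ X in Literature.MathematicalPhysics.QuantumManyBody.BoseGas.cellN (n + 1) L, (‖Θ X‖₊ : ENNReal) ^ 2) = 1 ∧ Literature.MathematicalPhysics.QuantumManyBody.BoseGas.periodicGroundStateEnergy v (n + 1) L ≠ ⊤ ∧ ∃ Ψ : ℕ → Literature.MathematicalPhysics.QuantumManyBody.BoseGas.PeriodicTrialState (n + 1) L, Filter.Tendsto (fun k => Literature.MathematicalPhysics.QuantumManyBody.BoseGas.periodicEnergy v (Ψ k)) Filter.atTop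 (nhds (Literature.MathematicalPhysics.QuantumManyBody.BoseGas.periodicGroundStateEnergy v (n + 1) L)) ∧ Filter.Tendsto (fun k => ∫⁻ X in Literature.MathematicalPhysics.QuantumManyBody.BoseGas.cellN (n + 1) L, (‖(Ψ k).ψ X - Θ X‖₊ : ENNReal) ^ 2) Filter.atTop (nhds 0)) → ∀ ρΦ : Literature.MathematicalPhysics.QuantumManyBody.BoseGas.Space → ENNReal, ρΦ = (fun x => ((n : ENNReal) + 1) * ∫⁻ Y : Literature.MathematicalPhysics.QuantumManyBody.BoseGas.Config n, (‖Φ (Matrix.vecCons x Y)‖₊ : ENNReal) ^ 2) → ∀ mΦ : Literature.MathematicalPhysics.QuantumManyBody.BoseGas.Config n → ENNReal, mΦ = (fun Y => ∫⁻ z : Literature.MathematicalPhysics.QuantumManyBody.BoseGas.Space, (‖Φ (Matrix.vecCons z Y)‖₊ : ENNReal) ^ 2) → ∀ lam : Literature.MathematicalPhysics.QuantumManyBody.BoseGas.Space → Literature.MathematicalPhysics.QuantumManyBody.BoseGas.Config n → ENNReal, lam = (fun x Y => ((Literature.MathematicalPhysics.QuantumManyBody.BoseGas.cellN (n + 1)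 L).indicator (fun X => (‖Θ X‖₊ : ENNReal) ^ 2) (Matrix.vecCons x Y)) / ∫⁻ z : Literature.MathematicalPhysics.QuantumManyBody.BoseGas.Space, ((Literature.MathematicalPhysics.QuantumManyBody.BoseGas.cellN (n + 1) L).indicator (fun X => (‖Θ X‖₊ : ENNReal) ^ 2) (Matrix.vecCons z Y))) → ∀ π : Literature.MathematicalPhysics.QuantumManyBody.BoseGas.Space → Literature.MathematicalPhysics.QuantumManyBody.BoseGas.Config n → ENNReal, π = (fun x Y => lam x Y * mΦ Y / ∫⁻ W : Literature.MathematicalPhysics.QuantumManyBody.BoseGas.Config n, lam x W * mΦ W) → ∀ b : Literature.MathematicalPhysics.QuantumManyBody.BoseGas.Space → Literature.MathematicalPhysics.QuantumManyBody.BoseGas.Space → ENNReal, b = (fun x y => ENNReal.ofReal (L ^ 3) * ∫⁻ Y : Literature.MathematicalPhysics.QuantumManyBody.BoseGas.Config n, (((Literature.MathematicalPhysics.QuantumManyBody.BoseGas.cellN (n + 1) L).indicator (fun X => (‖Θ X‖₊ : ENNReal) ^ 2) (Matrix.vecCons x Y)) * ((Literature.MathematicalPhysics.QuantumManyBody.BoseGas.cellN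 (n + 1) L).indicator (fun X => (‖Θ X‖₊ : ENNReal) ^ 2) (Matrix.vecCons y Y))) ^ ((1 : ℝ) / 2)) → ∫⁻ x : Literature.MathematicalPhysics.QuantumManyBody.BoseGas.Space, ∫⁻ y : Literature.MathematicalPhysics.QuantumManyBody.BoseGas.Space, ρΦ x * ρΦ y * (b x y - ∫⁻ Y : Literature.MathematicalPhysics.QuantumManyBody.BoseGas.Config n, (π x Y * π y Y) ^ ((1 : ℝ) / 2)) ≤ ENNReal.ofReal η * ((n : ENNReal) + 1) ^ 2

/-- item stmt-AtomisticToContinuum-0826 · crux · rank 4 · closed · moot by None · by planner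
why it might fail: Box L=(N/ρ)^{1/3}→∞ at fixed ρ: every printed bound on n₊ pays the inverse kinetic gap L², so it is o(N) only up to L≲a(ρa³)^{-3/4-η} (Fournais2020 Thm 1.2; Junge2026 Cor 6); T=0 Bogoliubov expansions diverge in d=3; hard cores v=⊤ are admissible and c must be uniform in N.
sources: LiebSeiringerSolovejYngvason2005, Fournais2020, arXiv:2011.00309, Junge2026, arXiv:2603.20776, ChongLiangNam2026
[crux] PeriodicBEC: for every repulsive finite-range radial v there is ρ₀>0 such that for 0<ρ<ρ₀
there is c>0 with: for all large N there is δ>0 such that every PERIODIC trial state Ψ on the torus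
of side L=(N/ρ)^{1/3} with periodicEnergy ≤ E₀^per(N,L)+δ has constant-mode occupation ⟨Ψ,n₀Ψ⟩ =
condensateOccupation N L Ψ ≥ cN. The open problem in the literature's own (translation-invariant)
setting; Fournais2020 Thm 1.2 gives it on scales L ≤ C(ρa³)^{-δ}(ρa)^{-1/2}, Junge2026 Cor. 6
(Neumann) up to a(ρa³)^{-3/4-η}. Sources: LiebSeiringerSolovejYngvason2005 Ch. 5; Fournais2020;
Junge2026; ChongLiangNam2026. -/
@[route_item "route-AtomisticToContinuum-BECTiltCommutation"]
def PeriodicBEC : Prop :=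
  ∀ v : ℝ → ENNReal, Literature.MathematicalPhysics.QuantumManyBody.BoseGas.IsRepulsiveFiniteRange v → ∃ ρ₀ : ℝ, 0 < ρ₀ ∧ ∀ ρ : ℝ, 0 < ρ → ρ < ρ₀ → ∃ c : ℝ, 0 < c ∧ ∀ᶠ N : ℕ in Filter.atTop, ∃ δ : ENNReal, 0 < δ ∧ ∀ Ψ : Literature.MathematicalPhysics.QuantumManyBody.BoseGas.PeriodicTrialState N (Literature.MathematicalPhysics.QuantumManyBody.BoseGas.sideLength ρ N), Literature.MathematicalPhysics.QuantumManyBody.BoseGas.periodicEnergy v Ψ ≤ Literature.MathematicalPhysics.QuantumManyBody.BoseGas.periodicGroundStateEnergy v N (Literature.MathematicalPhysics.QuantumManyBody.BoseGas.sideLength ρ N) + δ → ENNReal.ofReal (c * N) ≤ Literature.MathematicalPhysics.QuantumManyBody.BoseGas.condensateOccupation N (Literature.MathematicalPhysics.QuantumManyBody.BoseGas.sideLength ρ N) Ψ.ψ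

/-- item stmt-AtomisticToContinuum-5121 · support · rank 9 · closed · moot by None · by planner
sources: PenroseOnsager1956, LSSY2005, folklore (Bhattacharyya/Hellinger inequalities)
[support] (affinity algebra, per instance, no ground-state hypotheses — the glue of layer 1) For any
n, L, η ≥ 0, c and measurable Φ, Θ : Config(n+1) → ℂ with Φ supported in the box and ∫|Φ|² = 1: the
TiltCommutation inequality (error η), the BulkIndistinguishability inequality (error η) and the
weighted torus coherence c·N·(∫_cell ρ_Φ)² ≤ N∫∫ρ_Φ(x)ρ_Φ(y)b_Θ(x,y) imply Q(Φ) :=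
∫dY(∫√ρ_Φ(x)·|Φ(x,Y)|dx)² ≥ (c − 4η − 4√η)·N. Proof (true constant 2η+2√η): Q =
(1/N)∫∫√(ρ_Φ(x)ρ_Φ(y))γ^abs_Φ(x,y) with γ^abs_Φ(x,y) = ∫√(a_x a_y)dY, a_x(Y) = N|Φ(x,Y)|²; Hellinger
step |∫√(a_x a_y) − ∫√(b_x b_y)| ≤ √(‖a_x−b_x‖₁·∫a_y) + √(∫b_x·‖a_y−b_y‖₁) (|√s−√t|² ≤ |s−t|,
Cauchy–Schwarz) with b_x = ρ_Φ(x)π_x, ∫√(b_x b_y) = √(ρ_Φ(x)ρ_Φ(y))·BC(π_x,π_y); Cauchy–Schwarz in x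
against ρ_Φ (total mass N) turns the C1 error ηN into 2√η·N + ηN; C2 gives ∫∫ρρBC ≥ ∫∫ρρ b_Θ − ηN²;
the coherence hypothesis gives ∫∫ρρ b_Θ ≥ cN². [deps: TiltCommutation, BulkIndistinguishability]
[difficulty: provable-now] -/
@[route_item "route-AtomisticToContinuum-BECTiltCommutation"]
def PairAlgebra : Prop :=
  ∀ (n : ℕ) (L η c : ℝ) (Φ Θ : Literature.MathematicalPhysics.QuantumManyBody.BoseGas.Config (n + 1) → ℂ), 0 ≤ η → Measurable Φ → Measurable Θ → (∀ X, X ∉ Literature.MathematicalPhysics.QuantumManyBody.BoseGas.boxN (n + 1) L → Φ X = 0) → (∫⁻ X, (‖Φ X‖₊ : ENNReal) ^ 2) = 1 → ∀ ρΦ : Literature.MathematicalPhysics.QuantumManyBody.BoseGas.Space → ENNReal, ρΦ = (fun x => ((n : ENNReal) + 1) * ∫⁻ Y : Literature.MathematicalPhysics.QuantumManyBody.BoseGas.Config n, (‖Φ (Matrix.vecCons x Y)‖₊ : ENNReal) ^ 2) → ∀ mΦ : Literature.MathematicalPhysics.QuantumManyBody.BoseGas.Config n → ENNReal, mΦ =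 (fun Y => ∫⁻ z : Literature.MathematicalPhysics.QuantumManyBody.BoseGas.Space, (‖Φ (Matrix.vecCons z Y)‖₊ : ENNReal) ^ 2) → ∀ lam : Literature.MathematicalPhysics.QuantumManyBody.BoseGas.Space → Literature.MathematicalPhysics.QuantumManyBody.BoseGas.Config n → ENNReal, lam = (fun x Y => ((Literature.MathematicalPhysics.QuantumManyBody.BoseGas.cellN (n + 1) L).indicator (fun X => (‖Θ X‖₊ : ENNReal) ^ 2) (Matrix.vecCons x Y)) / ∫⁻ z : Literature.MathematicalPhysics.QuantumManyBody.BoseGas.Space, ((Literature.MathematicalPhysics.QuantumManyBody.BoseGas.cellN (n + 1) L).indicator (fun X => (‖Θ X‖₊ : ENNReal) ^ 2) (Matrix.vecCons z Y))) → ∀ π : Literature.MathematicalPhysics.QuantumManyBody.BoseGas.Space → Literature.MathematicalPhysics.QuantumManyBody.BoseGas.Config n → ENNReal, π = (fun x Y => lam x Y * mΦ Y / ∫⁻ W : Literature.MathematicalPhysics.QuantumManyBody.BoseGas.Config n, lam x W * mΦ W) → ∀ b : Literature.MathematicalPhysics.QuantumManyBody.BoseGas.Space → Literature.MathematicalPhysics.QuantumManyBody.BoseGas.Space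 → ENNReal, b = (fun x y => ENNReal.ofReal (L ^ 3) * ∫⁻ Y : Literature.MathematicalPhysics.QuantumManyBody.BoseGas.Config n, (((Literature.MathematicalPhysics.QuantumManyBody.BoseGas.cellN (n + 1) L).indicator (fun X => (‖Θ X‖₊ : ENNReal) ^ 2) (Matrix.vecCons x Y)) * ((Literature.MathematicalPhysics.QuantumManyBody.BoseGas.cellN (n + 1) L).indicator (fun X => (‖Θ X‖₊ : ENNReal) ^ 2) (Matrix.vecCons y Y))) ^ ((1 : ℝ) / 2)) → ∫⁻ x : Literature.MathematicalPhysics.QuantumManyBody.BoseGas.Space, ∫⁻ Y : Literature.MathematicalPhysics.QuantumManyBody.BoseGas.Config n, ((((n : ENNReal) + 1) * (‖Φ (Matrix.vecCons x Y)‖₊ : ENNReal) ^ 2 - ρΦ x * π x Y) + (ρΦ x * π x Y - ((n : ENNReal) + 1) * (‖Φ (Matrix.vecCons x Y)‖₊ : ENNReal) ^ 2)) ≤ ENNReal.ofReal η * ((n : ENNReal) + 1) → ∫⁻ x : Literature.MathematicalPhysics.QuantumManyBody.BoseGas.Space, ∫⁻ y : Literature.MathematicalPhysics.QuantumManyBody.BoseGas.Space,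 ρΦ x * ρΦ y * (b x y - ∫⁻ Y : Literature.MathematicalPhysics.QuantumManyBody.BoseGas.Config n, (π x Y * π y Y) ^ ((1 : ℝ) / 2)) ≤ ENNReal.ofReal η * ((n : ENNReal) + 1) ^ 2 → ENNReal.ofReal c * ((n : ENNReal) + 1) * (∫⁻ x in Literature.MathematicalPhysics.QuantumManyBody.BoseGas.cell L, ρΦ x) ^ 2 ≤ ((n : ENNReal) + 1) * ∫⁻ x : Literature.MathematicalPhysics.QuantumManyBody.BoseGas.Space, ∫⁻ y : Literature.MathematicalPhysics.QuantumManyBody.BoseGas.Space, ρΦ x * ρΦ y * b x y → ENNReal.ofReal ((c - 4 * η - 4 * Real.sqrt η) * ((n : ℝ) + 1)) ≤ ∫⁻ Y : Literature.MathematicalPhysics.QuantumManyBody.BoseGas.Config n, (∫⁻ x : Literature.MathematicalPhysics.QuantumManyBody.BoseGas.Space, (ρΦ x) ^ ((1 : ℝ) / 2) * (‖Φ (Matrix.vecCons x Y)‖₊ : ENNReal)) ^ 2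

/-- item stmt-AtomisticToContinuum-5122 · support · rank 9 · closed · moot by None · by planner
sources: Fournais2020, ReedSimonIV1978, LSSY2005
[support] PeriodicBEC → weighted torus coherence for ground states: for every repulsive finite-range
v there is ρ₀ such that for ρ<ρ₀ there is c>0 with, for all large N = n+1 and every Dirichlet ground
state Φ, SOME periodic ground state Θ (a translate of an L²-limit of a periodic minimising sequence)
satisfying c·N·(∫_cell ρ_Φ)² ≤ N∫∫ρ_Φ(x)ρ_Φ(y)b_Θ(x,y). Proof: E₀^per < ∞ at low density (disjoint
symmetric bumps, ρR₀³ small); bounded kinetic energy + Rellich on the torus give L²-limits Θ₀ of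
minimising sequences, and n₀(Θ₀) ≥ cN by PeriodicBEC and L²-continuity of condensateOccupation;
translates Θ_t are again such limits; for f = ρ_Φ ≥ 0: N∫∫f f b_{Θ_t} ≥ L³⟨f,γ_{Θ_t}f⟩ =
L³N∫dY|∫f(x)Θ₀(x+t,Y)dx|² (torus change of variables), and the t-average of the last integral is ≥
|average|² = L⁻⁶(∫f)²|∫Θ₀(z,Y)dz|² (Jensen), i.e. avg_t N∫∫ffb_{Θ_t} ≥ n₀(Θ₀)(∫f)² ≥ cN(∫f)²; pick t
above the average. No Fourier series needed. [deps: PeriodicBEC] [difficulty: L] -/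
@[route_item "route-AtomisticToContinuum-BECTiltCommutation"]
def TorusAveraging : Prop :=
  (∀ v : ℝ → ENNReal, Literature.MathematicalPhysics.QuantumManyBody.BoseGas.IsRepulsiveFiniteRange v → ∃ ρ₀ : ℝ, 0 < ρ₀ ∧ ∀ ρ : ℝ, 0 < ρ → ρ < ρ₀ → ∃ c : ℝ, 0 < c ∧ ∀ᶠ N : ℕ in Filter.atTop, ∃ δ : ENNReal, 0 < δ ∧ ∀ Ψ : Literature.MathematicalPhysics.QuantumManyBody.BoseGas.PeriodicTrialState N (Literature.MathematicalPhysics.QuantumManyBody.BoseGas.sideLength ρ N), Literature.MathematicalPhysics.QuantumManyBody.BoseGas.periodicEnergy v Ψ ≤ Literature.MathematicalPhysics.QuantumManyBody.BoseGas.periodicGroundStateEnergy v N (Literature.MathematicalPhysics.QuantumManyBody.BoseGas.sideLength ρ N) + δ → ENNReal.ofReal (c * N) ≤ Literature.MathematicalPhysics.QuantumManyBody.BoseGas.condensateOccupation N (Literature.MathematicalPhysics.QuantumManyBody.BoseGas.sideLength ρ N) Ψ.ψ) → (∀ v : ℝ → ENNReal, Literature.MathematicalPhysics.QuantumManyBody.BoseGas.IsRepulsiveFiniteRange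 v → ∃ ρ₀ : ℝ, 0 < ρ₀ ∧ ∀ ρ : ℝ, 0 < ρ → ρ < ρ₀ → ∃ c : ℝ, 0 < c ∧ ∀ᶠ n : ℕ in Filter.atTop, ∀ L : ℝ, L = Literature.MathematicalPhysics.QuantumManyBody.BoseGas.sideLength ρ (n + 1) → ∀ Φ : Literature.MathematicalPhysics.QuantumManyBody.BoseGas.Config (n + 1) → ℂ, (Measurable Φ ∧ (∀ X, X ∉ Literature.MathematicalPhysics.QuantumManyBody.BoseGas.boxN (n + 1) L → Φ X = 0) ∧ (∫⁻ X, (‖Φ X‖₊ : ENNReal) ^ 2) = 1 ∧ Literature.MathematicalPhysics.QuantumManyBody.BoseGas.groundStateEnergy v (n + 1) L ≠ ⊤ ∧ ∃ Ψ : ℕ → Literature.MathematicalPhysics.QuantumManyBody.BoseGas.TrialState (n + 1) L, Filter.Tendsto (fun k => Literature.MathematicalPhysics.QuantumManyBody.BoseGas.energy v (Ψ k)) Filter.atTop (nhds (Literature.MathematicalPhysics.QuantumManyBody.BoseGas.groundStateEnergy v (n + 1) L)) ∧ Filter.Tendsto (fun k => ∫⁻ X, (‖(Ψ k).ψ X -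 Φ X‖₊ : ENNReal) ^ 2) Filter.atTop (nhds 0)) → ∃ Θ : Literature.MathematicalPhysics.QuantumManyBody.BoseGas.Config (n + 1) → ℂ, (Measurable Θ ∧ (∫⁻ X in Literature.MathematicalPhysics.QuantumManyBody.BoseGas.cellN (n + 1) L, (‖Θ X‖₊ : ENNReal) ^ 2) = 1 ∧ Literature.MathematicalPhysics.QuantumManyBody.BoseGas.periodicGroundStateEnergy v (n + 1) L ≠ ⊤ ∧ ∃ Ψ : ℕ → Literature.MathematicalPhysics.QuantumManyBody.BoseGas.PeriodicTrialState (n + 1) L, Filter.Tendsto (fun k => Literature.MathematicalPhysics.QuantumManyBody.BoseGas.periodicEnergy v (Ψ k)) Filter.atTop (nhds (Literature.MathematicalPhysics.QuantumManyBody.BoseGas.periodicGroundStateEnergy v (n + 1) L)) ∧ Filter.Tendsto (fun k => ∫⁻ X in Literature.MathematicalPhysics.QuantumManyBody.BoseGas.cellN (n + 1) L, (‖(Ψ k).ψ X - Θ X‖₊ : ENNReal) ^ 2) Filter.atTop (nhds 0)) ∧ (∀ ρΦ : Literature.MathematicalPhysics.QuantumManyBody.BoseGas.Space → ENNReal, ρΦ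 = (fun x => ((n : ENNReal) + 1) * ∫⁻ Y : Literature.MathematicalPhysics.QuantumManyBody.BoseGas.Config n, (‖Φ (Matrix.vecCons x Y)‖₊ : ENNReal) ^ 2) → ∀ b : Literature.MathematicalPhysics.QuantumManyBody.BoseGas.Space → Literature.MathematicalPhysics.QuantumManyBody.BoseGas.Space → ENNReal, b = (fun x y => ENNReal.ofReal (L ^ 3) * ∫⁻ Y : Literature.MathematicalPhysics.QuantumManyBody.BoseGas.Config n, (((Literature.MathematicalPhysics.QuantumManyBody.BoseGas.cellN (n + 1) L).indicator (fun X => (‖Θ X‖₊ : ENNReal) ^ 2) (Matrix.vecCons x Y)) * ((Literature.MathematicalPhysics.QuantumManyBody.BoseGas.cellN (n + 1) L).indicator (fun X => (‖Θ X‖₊ : ENNReal) ^ 2) (Matrix.vecCons y Y))) ^ ((1 : ℝ) / 2)) → ENNReal.ofReal c * ((n : ENNReal) + 1) * (∫⁻ x in Literature.MathematicalPhysics.QuantumManyBody.BoseGas.cell L, ρΦ x) ^ 2 ≤ ((n : ENNReal) + 1) * ∫⁻ x : Literature.MathematicalPhysics.QuantumManyBody.BoseGas.Space, ∫⁻ y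 : Literature.MathematicalPhysics.QuantumManyBody.BoseGas.Space, ρΦ x * ρΦ y * b x y))

/-- item stmt-AtomisticToContinuum-5123 · support · rank 9 · closed · moot by None · by planner
sources: ReedSimonIV1978, LSSY2005, LiebSeiringerSolovejYngvason2005, in-tree AtomisticToContinuum.BECInfraredBound.bec_of_zeroMode
[support] Dirichlet ground-state coherence → the conjunct: if for every repulsive finite-range v
there are ρ₀, and for ρ<ρ₀ some c>0, such that for all large N every Dirichlet ground state Φ (as in
TiltCommutation) has Q(Φ) = ∫dY(∫√ρ_Φ(x)|Φ(x,Y)|dx)² ≥ cN, then BoseEinsteinCondensation. Proof: fix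
v, ρ < ρ₀' := min(ρ₀, finiteness threshold) so that E₀(N,L) < ∞ for large N; if for every δ>0 some
δ-near-minimiser had maxOccupation < (c/2)N, a minimising sequence of such states would converge in
L² (Rellich for C¹ functions vanishing off the box with bounded Dirichlet integral) to a ground
state Φ; uniqueness/positivity of the Dirichlet ground state (Perron–Frobenius for −Δ+V on the
connected admissible region, Reed–Simon XIII.47; hard cores: connectedness at low density) gives
Φ(·,Y) of constant phase, so the occupation of the FIXED normalised mode u = √(ρ_Φ/N) in Ψ_k tends
to N∫|∫ūΦ|² = Q(Φ) ≥ cN — contradiction; finish with occupation_le_maxOccupation and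
le_condensateNumber (pattern of AtomisticToContinuum.BECInfraredBound.bec_of_zeroMode). This is
where all near-minimiser/compactness/phase plumbing of the conjunct's variational formalisation is
paid, once. [difficulty: L] -/
@[route_item "route-AtomisticToContinuum-BECTiltCommutation"]
def GroundStateReduction : Prop :=
  (∀ v : ℝ → ENNReal, Literature.MathematicalPhysics.QuantumManyBody.BoseGas.IsRepulsiveFiniteRange v → ∃ ρ₀ : ℝ, 0 < ρ₀ ∧ ∀ ρ : ℝ, 0 < ρ → ρ < ρ₀ → ∃ c : ℝ, 0 < c ∧ ∀ᶠ n : ℕ in Filter.atTop, ∀ L : ℝ, L = Literature.MathematicalPhysics.QuantumManyBody.BoseGas.sideLength ρ (n + 1) → ∀ Φ : Literature.MathematicalPhysics.QuantumManyBody.BoseGas.Config (n + 1) → ℂ, (Measurable Φ ∧ (∀ X, X ∉ Literature.MathematicalPhysics.QuantumManyBody.BoseGas.boxN (n + 1) L → Φ X = 0) ∧ (∫⁻ X, (‖Φ X‖₊ : ENNReal) ^ 2) = 1 ∧ Literature.MathematicalPhysics.QuantumManyBody.BoseGas.groundStateEnergy v (n + 1) L ≠ ⊤ ∧ ∃ Ψ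 : ℕ → Literature.MathematicalPhysics.QuantumManyBody.BoseGas.TrialState (n + 1) L, Filter.Tendsto (fun k => Literature.MathematicalPhysics.QuantumManyBody.BoseGas.energy v (Ψ k)) Filter.atTop (nhds (Literature.MathematicalPhysics.QuantumManyBody.BoseGas.groundStateEnergy v (n + 1) L)) ∧ Filter.Tendsto (fun k => ∫⁻ X, (‖(Ψ k).ψ X - Φ X‖₊ : ENNReal) ^ 2) Filter.atTop (nhds 0)) → ∀ ρΦ : Literature.MathematicalPhysics.QuantumManyBody.BoseGas.Space → ENNReal, ρΦ = (fun x => ((n : ENNReal) + 1) * ∫⁻ Y : Literature.MathematicalPhysics.QuantumManyBody.BoseGas.Config n, (‖Φ (Matrix.vecCons x Y)‖₊ : ENNReal) ^ 2) → ENNReal.ofReal (c * ((n : ℝ) + 1)) ≤ ∫⁻ Y : Literature.MathematicalPhysics.QuantumManyBody.BoseGas.Config n, (∫⁻ x : Literature.MathematicalPhysics.QuantumManyBody.BoseGas.Space, (ρΦ x) ^ ((1 : ℝ) / 2) * (‖Φ (Matrix.vecCons x Y)‖₊ : ENNReal)) ^ 2) → Literature.MathematicalPhysics.QuantumManyBo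dy.BoseGas.BoseEinsteinCondensation

/-- item stmt-AtomisticToContinuum-5124 · assembly · rank 1 · closed · moot by None · by planner
sources: LSSY2005, PenroseOnsager1956
[assembly] TiltCommutation → BulkIndistinguishability → PeriodicBEC → PairAlgebra → TorusAveraging →
GroundStateReduction → BoseEinsteinCondensation (the conjunct constant
Literature.MathematicalPhysics.QuantumManyBody.BoseGas.BoseEinsteinCondensation). -/
@[route_item "route-AtomisticToContinuum-BECTiltCommutation"]
def Assembly : Prop :=
  TiltCommutation → BulkIndistinguishability → PeriodicBEC → PairAlgebra → TorusAveraging → GroundStateReduction → Literature.MathematicalPhysics.QuantumManyBody.BoseGas.BoseEinsteinCondensation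

end Summit.AtomisticToContinuum.BoseEinsteinCondensation.Theses.BECTiltCommutation
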